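import Summits.KontsevichZagierPeriods.Zeta5Search.Barrier.ConeGammaLemmaFWinBoxTables

/-!
# ζ(5) search — BARRIER: windowed Lemma F on BOXES — soundness, part 3: the hull invariant, the slope enclosures and
# the per-cut accumulator

HONEST FRAMING (cell `pub-zeta5`): systematic search; no irrationality claim unless kernel-certified. MODEL-side objects
under Brown–Zudilin's (28)+(30) ((28) observed, not proved): P2 g24's windowed Lemma-F-with-members bound (cert-2 g35's
`winForm`, `phi30_aOfS_le_winForm`) and `Φ = phi30`. This file proves that the per-cut accumulator `cutAcc` of the box checker
encloses the variation of the feature part of the bound over the box (the hull invariant); the box theorems are in the sequel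
`ConeGammaLemmaFWinBoxCert`. Nothing here is about C₀ / C₁ / δ₂₈ (NO γ-statement), any γ of record, the cone's sup, C2 (OPEN),
S-E (CONJECTURED), (TD_A) or `ζ(5)`; records in print UNMOVED. Theory seat cert-2 g36 (item «WINDOWED LEMMA F ON BOXES —
KERNEL»), part 4.

* the hull invariant «for every `t` of the box there is `v` in the hull with `S(t) − S(t_c) = Σ_i (t_i − t_{c,i}) v_i`»
  (written out in every statement): `hull_zero`, `hull_addHull`, `qSlope_sound`, `logSlope1_sound`, `accQ_sound`, `accLog_sound`, **`cutAcc_sound`**;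
-/

open Finset Set MeasureTheory
open Literature.Analysis.ValidatedNumerics.NumericsMP

namespace Summit.KontsevichZagierPeriods.Zeta5Search.Barrier.ConeGamma

namespace LemmaFWinBox

open LemmaFBox (SC KT lnNat SC_pos coef featVal minNum maxNum sum8 box centre minNum_le le_maxNum centre_mem
  abs_sub_centre_le abs_le_of_mem mem_log_of_range cast_toNat_of_pos getD_map_range featVal_sub_eq_sum sum8_eq_sum
  aOfS_normalise)
open LemmaFWin (jT dG memShape memT memC winForm winFormL winFormL_eq_winForm zI mem_zI winEnc winEnc_sound cutsOK
  sortedLE_spec mems_spec jT_zero)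

/-! ### The hull invariant -/

/- The HULL INVARIANT used throughout (written out in every statement; no Prop-valued definition):
«for every `t` of the box there is `v` with `v_i ∈ g_i` and `S(t) − S(t_c) = Σ_i (t_i − t_{c,i})·v_i»,
`t_c = centre D lo hi`. -/

/-- The zero hull encloses the zero function. -/
theorem hull_zero (D : ℕ) (lo hi : List ℕ) :
    ∀ t ∈ box D lo hi, ∃ v : Fin 8 → ℝ, (∀ i : Fin 8, MI.mem SC (v i) (getI zeroHull i)) ∧
      (0 : ℝ) - 0 = ∑ i : Fin 8, (t i - centre D lo hi i) * v i := by
  intro t _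
  refine ⟨fun _ => 0, fun i => ?_, by simp⟩
  unfold getI zeroHull
  rw [getD_map_range _ _ i.isLt]
  exact mem_zI

/-- Entries of `addHull`. -/
theorem getI_addHull (g : List MI) (I : MI) (k : ℤ) (f : List ℤ) (i : Fin 8) :
    getI (addHull g I k f) i = (getI g i).add (I.mulInt (k * coef f i)) := by
  unfold addHull getI
  rw [getD_map_range _ _ i.isLt]

/-- **One term**: a secant representation `G(t) − G(t_c) = θ·(x_f(t) − x_f(t_c))` with `θ ∈ I` extends the invariant
from `S` to `S + k·G`. -/
theorem hull_addHull {D : ℕ} {lo hi : List ℕ} {g : List MI} {S : (Fin 8 → ℝ) → ℝ}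
    (hS : ∀ t ∈ box D lo hi, ∃ v : Fin 8 → ℝ, (∀ i : Fin 8, MI.mem SC (v i) (getI g i)) ∧
      S t - S (centre D lo hi) = ∑ i : Fin 8, (t i - centre D lo hi i) * v i)
    {I : MI} {k : ℤ} {f : List ℤ} {G : (Fin 8 → ℝ) → ℝ}
    (hG : ∀ t ∈ box D lo hi, ∃ θ : ℝ, MI.mem SC θ I ∧
      G t - G (centre D lo hi) = θ * (featVal f t - featVal f (centre D lo hi))) :
    ∀ t ∈ box D lo hi, ∃ v : Fin 8 → ℝ, (∀ i : Fin 8, MI.mem SC (v i) (getI (addHull g I k f) i)) ∧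
      (S t + (k : ℝ) * G t) - (S (centre D lo hi) + (k : ℝ) * G (centre D lo hi))
        = ∑ i : Fin 8, (t i - centre D lo hi i) * v i := by
  intro t ht
  obtain ⟨v, hv, hSv⟩ := hS t ht
  obtain ⟨θ, hθ, hGθ⟩ := hG t ht
  refine ⟨fun i => v i + θ * ((k * coef f i : ℤ) : ℝ), fun i => ?_, ?_⟩
  · rw [getI_addHull]
    exact MI.mem_add (hv i) (MI.mem_mulInt hθ _)
  · have e : featVal f t - featVal f (centre D lo hi) = ∑ i : Fin 8, (t i - centre D lo hi i) * (coef f i : ℝ) := by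
      rw [← featVal_sub_eq_sum, LemmaFBox.featVal_sub]
    have : S t + (k : ℝ) * G t - (S (centre D lo hi) + (k : ℝ) * G (centre D lo hi))
        = (S t - S (centre D lo hi)) + (k : ℝ) * (G t - G (centre D lo hi)) := by ring
    rw [this, hSv, hGθ, e, Finset.mul_sum, Finset.mul_sum, ← Finset.sum_add_distrib]
    refine Finset.sum_congr rfl fun i _ => ?_
    push_cast; ring

/-! ### The two slope enclosures -/

/-- `⌊(A/E)·(m/D)⌋ = A·m/(E·D)` in `ℕ`. -/
theorem floor_frac_mul (A E m D : ℕ) :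
    ⌊((A : ℝ) / E) * ((m : ℝ) / D)⌋₊ = A * m / (E * D) := by
  rw [div_mul_div_comm, ← Nat.cast_mul, ← Nat.cast_mul, Nat.floor_div_eq_div]

/-- **The hinge-slope enclosure is sound**: on the box, `q_U(x_f(t)) − q_U(x_f(t_c)) = θ·(x_f(t) − x_f(t_c))` with
`θ ∈ qSlope` (`U = A/E > 0`, feature non-negative on the box). -/
theorem qSlope_sound {D E A : ℕ} (hD : 0 < D) (hE : 0 < E) (hA : 0 < A) {lo hi : List ℕ}
    (hle : ∀ i : Fin 8, lo.getD i 0 ≤ hi.getD i 0) {f : List ℤ} (hf : 0 ≤ minNum f lo hi) :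
    ∀ t ∈ box D lo hi, ∃ θ : ℝ, MI.mem SC θ (qSlope D E A lo hi f) ∧
      qH ((A : ℝ) / E) (featVal f t) - qH ((A : ℝ) / E) (featVal f (centre D lo hi))
        = θ * (featVal f t - featVal f (centre D lo hi)) := by
  intro t ht
  have hD' : (0 : ℝ) < D := by exact_mod_cast hD
  have hU : (0 : ℝ) < (A : ℝ) / E := by positivity
  have hc := centre_mem hD hle
  set U : ℝ := (A : ℝ) / E with hUdef
  set L : ℝ := ((minNum f lo hi).toNat : ℝ) / D with hL
  set H : ℝ := ((maxNum f lo hi).toNat : ℝ) / D with hH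
  -- the feature range on the box
  have hmn : ((minNum f lo hi : ℤ) : ℝ) = ((minNum f lo hi).toNat : ℝ) := by
    have : ((minNum f lo hi).toNat : ℤ) = minNum f lo hi := Int.toNat_of_nonneg hf
    exact_mod_cast this.symm
  have hL0 : 0 ≤ L := by positivity
  have rng : ∀ u ∈ box D lo hi, L ≤ featVal f u ∧ featVal f u ≤ H := by
    intro u hu
    have h1 := minNum_le hu f; have h2 := le_maxNum hu f
    rw [hmn] at h1
    have hmx : 0 ≤ maxNum f lo hi := by
      have : (0 : ℝ) ≤ (maxNum f lo hi : ℝ) := le_trans (by rw [← hmn]; exact_mod_cast hf) (h1.trans h2)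
      exact_mod_cast this
    have hmx' : ((maxNum f lo hi : ℤ) : ℝ) = ((maxNum f lo hi).toNat : ℝ) := by
      have : ((maxNum f lo hi).toNat : ℤ) = maxNum f lo hi := Int.toNat_of_nonneg hmx
      exact_mod_cast this.symm
    rw [hmx'] at h2
    constructor
    · rw [hL, div_le_iff₀ hD']; exact h1
    · rw [hH, le_div_iff₀ hD']; exact h2
  obtain ⟨hxL, hxH⟩ := rng t ht
  obtain ⟨hcL, hcH⟩ := rng _ hc
  -- the slope bounds and membership
  have hNlo : ⌊U * L⌋₊ = A * (minNum f lo hi).toNat / (E * D) := floor_frac_mul _ _ _ _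
  have hNhi : ⌊U * H⌋₊ = A * (maxNum f lo hi).toNat / (E * D) := floor_frac_mul _ _ _ _
  have memθ : ∀ θ : ℝ, harmR ⌊U * L⌋₊ ≤ θ → θ ≤ harmR ⌊U * H⌋₊ → MI.mem SC θ (qSlope D E A lo hi f) := by
    intro θ h1 h2
    rw [hNlo] at h1; rw [hNhi] at h2
    have m1 := harmEnc_sound (A * (minNum f lo hi).toNat / (E * D))
    have m2 := harmEnc_sound (A * (maxNum f lo hi).toNat / (E * D))
    have hS : (0 : ℝ) ≤ SC := by exact_mod_cast SC_pos.le
    exact ⟨m1.1.trans (mul_le_mul_of_nonneg_right h1 hS), (mul_le_mul_of_nonneg_right h2 hS).trans m2.2⟩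
  set x := featVal f (centre D lo hi) with hx
  set y := featVal f t with hy
  rcases lt_trichotomy x y with hlt | heq | hgt
  · refine ⟨(qH U y - qH U x) / (y - x), memθ _ ?_ ?_, ?_⟩
    · rw [le_div_iff₀ (sub_pos.mpr hlt), mul_comm]; exact le_qH_sub hU hL0 hcL hlt.le
    · rw [div_le_iff₀ (sub_pos.mpr hlt), mul_comm]; exact qH_sub_le hU (hL0.trans hcL) hlt.le hxH
    · field_simp
  · refine ⟨harmR ⌊U * L⌋₊, memθ _ le_rfl (harmR_mono (Nat.floor_le_floor ?_)), ?_⟩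
    · exact mul_le_mul_of_nonneg_left (hcL.trans hcH) hU.le
    · rw [heq]; ring
  · refine ⟨(qH U x - qH U y) / (x - y), memθ _ ?_ ?_, ?_⟩
    · rw [le_div_iff₀ (sub_pos.mpr hgt), mul_comm]; exact le_qH_sub hU hL0 hxL hgt.le
    · rw [div_le_iff₀ (sub_pos.mpr hgt), mul_comm]; exact qH_sub_le hU (hL0.trans hxL) hgt.le hcH
    · field_simp; ring

/-- **The `x log x`-slope enclosure is sound**: on the box, `y log y − x log x = θ·(y − x)` with `θ ∈ logSlope1`
(feature positive on the box). -/
theorem logSlope1_sound {D : ℕ} (hD : 0 < D) {LD : MI} (hLD : MI.mem SC (Real.log D) LD) {lo hi : List ℕ}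
    (hle : ∀ i : Fin 8, lo.getD i 0 ≤ hi.getD i 0) {f : List ℤ} (hf : 0 < minNum f lo hi) {I : MI}
    (hI : logSlope1 LD lo hi f = some I) :
    ∀ t ∈ box D lo hi, ∃ θ : ℝ, MI.mem SC θ I ∧
      mulLog (featVal f t) - mulLog (featVal f (centre D lo hi)) = θ * (featVal f t - featVal f (centre D lo hi)) := by
  intro t ht
  have hD' : (0 : ℝ) < D := by exact_mod_cast hD
  have hc := centre_mem hD hle
  unfold logSlope1 at hI
  cases hLA : lnNat (minNum f lo hi).toNat with
  | none => rw [hLA] at hI; simp at hI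
  | some LA =>
    cases hLB : lnNat (maxNum f lo hi).toNat with
    | none => rw [hLA, hLB] at hI; simp at hI
    | some LB =>
      rw [hLA, hLB] at hI
      simp only [Option.some.injEq] at hI
      subst hI
      have mLA := MI.mem_logNat2 SC_pos hLA
      have mLB := MI.mem_logNat2 SC_pos hLB
      -- range
      have hmn : (0 : ℝ) < (minNum f lo hi : ℝ) := by exact_mod_cast hf
      have lo_pos : 0 < (minNum f lo hi : ℝ) / D := by positivity
      have rng : ∀ u ∈ box D lo hi, (minNum f lo hi : ℝ) / D ≤ featVal f u ∧ featVal f u ≤ (maxNum f lo hi : ℝ) / D :=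
        fun u hu => ⟨by rw [div_le_iff₀ hD']; exact minNum_le hu f, by rw [le_div_iff₀ hD']; exact le_maxNum hu f⟩
      -- membership of `1 + log ξ` for `ξ` in the range
      have memθ : ∀ ξ : ℝ, (minNum f lo hi : ℝ) / D ≤ ξ → ξ ≤ (maxNum f lo hi : ℝ) / D →
          MI.mem SC (1 + Real.log ξ) (((⟨LA.lo, LB.hi⟩ : MI).sub LD).add (MI.ofInt SC 1)) := by
        intro ξ h1 h2
        have hlog := mem_log_of_range hD hf mLA mLB hLD (x := ξ) (by rwa [div_le_iff₀ hD'] at h1)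
          (by rwa [le_div_iff₀ hD'] at h2)
        have := MI.mem_add hlog (MI.mem_ofInt SC 1)
        simpa [add_comm] using this
      set x := featVal f (centre D lo hi) with hx
      set y := featVal f t with hy
      obtain ⟨hxL, hxH⟩ := rng _ hc
      obtain ⟨hyL, hyH⟩ := rng t ht
      rcases lt_trichotomy x y with hlt | heq | hgt
      · -- mean value on `[x, y]`
        have hx0 : 0 < x := lo_pos.trans_le hxL
        obtain ⟨ξ, hξ, hslope⟩ := exists_hasDerivAt_eq_slope (fun z : ℝ => z * Real.log z)
          (fun z => Real.log z + 1) hlt Real.continuous_mul_log.continuousOn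
          (fun z hz => Real.hasDerivAt_mul_log (hx0.trans hz.1).ne')
        refine ⟨1 + Real.log ξ, memθ ξ (hxL.trans hξ.1.le) (hξ.2.le.trans hyH), ?_⟩
        unfold mulLog
        have hne : y - x ≠ 0 := (sub_pos.mpr hlt).ne'
        rw [add_comm, hslope]; field_simp
      · exact ⟨1 + Real.log x, memθ x hxL hxH, by rw [heq]; ring⟩
      · have hy0 : 0 < y := lo_pos.trans_le hyL
        obtain ⟨ξ, hξ, hslope⟩ := exists_hasDerivAt_eq_slope (fun z : ℝ => z * Real.log z)
          (fun z => Real.log z + 1) hgt Real.continuous_mul_log.continuousOn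
          (fun z hz => Real.hasDerivAt_mul_log (hy0.trans hz.1).ne')
        refine ⟨1 + Real.log ξ, memθ ξ (hyL.trans hξ.1.le) (hξ.2.le.trans hxH), ?_⟩
        unfold mulLog
        have hne : x - y ≠ 0 := (sub_pos.mpr hgt).ne'
        rw [add_comm, hslope]; field_simp; ring

/-! ### Feature vectors of merged tables -/

/-- Feature vectors of `insertTab e F` come from `e` or `F`. -/
theorem snd_mem_insertTab (e : ℤ × List ℤ) : ∀ (F : List (ℤ × List ℤ)) {f : ℤ × List ℤ},
    f ∈ insertTab e F → f.2 = e.2 ∨ ∃ f' ∈ F, f.2 = f'.2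
  | [], f, h => by simp [insertTab] at h; exact Or.inl (by rw [h])
  | f' :: F, f, h => by
    by_cases hf : f'.2 = e.2
    · rw [insertTab, if_pos hf] at h
      rcases List.mem_cons.mp h with h | h
      · exact Or.inl (by rw [h]; exact hf)
      · exact Or.inr ⟨f, by simp [h], rfl⟩
    · rw [insertTab, if_neg hf] at h
      rcases List.mem_cons.mp h with h | h
      · exact Or.inr ⟨f', by simp, by rw [h]⟩
      · rcases snd_mem_insertTab e F h with h' | ⟨f'', hf'', e'⟩
        · exact Or.inl h'
        · exact Or.inr ⟨f'', by simp [hf''], e'⟩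

/-- Feature vectors of `subTab A B` come from `A` or `B`. -/
theorem snd_mem_subTab (B : List (ℤ × List ℤ)) : ∀ (A : List (ℤ × List ℤ)) {f : ℤ × List ℤ},
    f ∈ subTab A B → (∃ a ∈ A, f.2 = a.2) ∨ ∃ b ∈ B, f.2 = b.2
  | [], f, h => by
    simp only [subTab, List.foldr_nil, List.mem_map] at h
    obtain ⟨b, hb, e⟩ := h
    exact Or.inr ⟨b, hb, by rw [← e]⟩
  | a :: A, f, h => by
    simp only [subTab, List.foldr_cons] at h
    rcases snd_mem_insertTab a _ h with h' | ⟨f', hf', e'⟩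
    · exact Or.inl ⟨a, by simp, h'⟩
    · rcases snd_mem_subTab B A (f := f') hf' with ⟨a', ha', e''⟩ | ⟨b, hb, e''⟩
      · exact Or.inl ⟨a', by simp [ha'], e'.trans e''⟩
      · exact Or.inr ⟨b, hb, e'.trans e''⟩

/-- Non-negativity of features passes to merged tables. -/
theorem minNum_mergePrev {lo hi : List ℕ} {T : List (ℤ × List ℤ)} {prev : Option (List (ℤ × List ℤ))}
    (hT : ∀ f ∈ T, 0 ≤ minNum f.2 lo hi) (hP : ∀ P, prev = some P → ∀ f ∈ P, 0 ≤ minNum f.2 lo hi) :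
    ∀ f ∈ mergePrev T prev, 0 ≤ minNum f.2 lo hi := by
  intro f hf
  cases hp : prev with
  | none => rw [hp] at hf; exact hT f hf
  | some P =>
    rw [hp] at hf
    rcases snd_mem_subTab P T hf with ⟨a, ha, e⟩ | ⟨b, hb, e⟩
    · rw [e]; exact hT a ha
    · rw [e]; exact hP P hp b hb

/-! ### The accumulators -/

/-- **Hinge terms of a table**: `accQ` extends the invariant by `entG F (q_{A/E})`. -/
theorem accQ_sound {D E A : ℕ} (hD : 0 < D) (hE : 0 < E) (hA : 0 < A) {lo hi : List ℕ}
    (hle : ∀ i : Fin 8, lo.getD i 0 ≤ hi.getD i 0) :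
    ∀ (F : List (ℤ × List ℤ)) {g : List MI} {S : (Fin 8 → ℝ) → ℝ},
      (∀ t ∈ box D lo hi, ∃ v : Fin 8 → ℝ, (∀ i : Fin 8, MI.mem SC (v i) (getI g i)) ∧
        S t - S (centre D lo hi) = ∑ i : Fin 8, (t i - centre D lo hi i) * v i) →
      (∀ f ∈ F, 0 ≤ minNum f.2 lo hi) →
      ∀ t ∈ box D lo hi, ∃ v : Fin 8 → ℝ, (∀ i : Fin 8, MI.mem SC (v i) (getI (accQ D E A lo hi F g) i)) ∧
        (S t + entG F (qH ((A : ℝ) / E)) t) - (S (centre D lo hi) + entG F (qH ((A : ℝ) / E)) (centre D lo hi))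
          = ∑ i : Fin 8, (t i - centre D lo hi i) * v i
  | [], g, S, hS, _ => by simpa [accQ, entG] using hS
  | f :: F, g, S, hS, hF => by
    have h1 := hull_addHull hS (k := f.1) (qSlope_sound hD hE hA hle (hF f (by simp)))
    have h2 := accQ_sound hD hE hA hle F h1 (fun f' hf' => hF f' (by simp [hf']))
    simp only [accQ]
    refine fun t ht => ?_
    obtain ⟨v, hv, e⟩ := h2 t ht
    refine ⟨v, hv, ?_⟩
    simp only [entG] at e ⊢
    linarith

/-- **`x log x` terms of the tail table**: `accLog` extends the invariant by `−entG F (x log x)`. -/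
theorem accLog_sound {D : ℕ} (hD : 0 < D) {LD : MI} (hLD : MI.mem SC (Real.log D) LD) {lo hi : List ℕ}
    (hle : ∀ i : Fin 8, lo.getD i 0 ≤ hi.getD i 0) :
    ∀ (F : List (ℤ × List ℤ)) {g g' : List MI} {S : (Fin 8 → ℝ) → ℝ},
      (∀ t ∈ box D lo hi, ∃ v : Fin 8 → ℝ, (∀ i : Fin 8, MI.mem SC (v i) (getI g i)) ∧
        S t - S (centre D lo hi) = ∑ i : Fin 8, (t i - centre D lo hi i) * v i) →
      (∀ f ∈ F, f.1 ≠ 0 → 0 < minNum f.2 lo hi) → accLog LD lo hi F g = some g' →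
      ∀ t ∈ box D lo hi, ∃ v : Fin 8 → ℝ, (∀ i : Fin 8, MI.mem SC (v i) (getI g' i)) ∧
        (S t - entG F mulLog t) - (S (centre D lo hi) - entG F mulLog (centre D lo hi))
          = ∑ i : Fin 8, (t i - centre D lo hi i) * v i
  | [], g, g', S, hS, _, h => by
    simp only [accLog, Option.some.injEq] at h
    subst h; simpa [entG] using hS
  | f :: F, g, g', S, hS, hF, h => by
    simp only [accLog] at h
    by_cases hf0 : f.1 = 0
    · rw [if_pos hf0] at h
      have h2 := accLog_sound hD hLD hle F hS (fun f' hf' => hF f' (by simp [hf'])) h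
      refine fun t ht => ?_
      obtain ⟨v, hv, e⟩ := h2 t ht
      refine ⟨v, hv, ?_⟩
      simp only [entG, hf0, Int.cast_zero, zero_mul, zero_add] at e ⊢
      exact e
    · rw [if_neg hf0] at h
      cases hI : logSlope1 LD lo hi f.2 with
      | none => rw [hI] at h; simp at h
      | some I =>
        rw [hI] at h
        have h1 := hull_addHull hS (k := -f.1) (logSlope1_sound hD hLD hle (hF f (by simp) hf0) hI)
        have h2 := accLog_sound hD hLD hle F h1 (fun f' hf' => hF f' (by simp [hf'])) h
        refine fun t ht => ?_
        obtain ⟨v, hv, e⟩ := h2 t ht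
        refine ⟨v, hv, ?_⟩
        simp only [entG, Int.cast_neg] at e ⊢
        linarith

/-- **Soundness of the per-cut accumulator**: `cutAcc` extends the invariant by `featRestP prev cuts Ts`. -/
theorem cutAcc_sound {D E : ℕ} (hD : 0 < D) (hE : 0 < E) {LD : MI} (hLD : MI.mem SC (Real.log D) LD) {lo hi : List ℕ}
    (hle : ∀ i : Fin 8, lo.getD i 0 ≤ hi.getD i 0) :
    ∀ (cuts : List ℕ) (Ts : List (List (ℤ × List ℤ))) (prev : Option (List (ℤ × List ℤ))) {g g' : List MI}
      {S : (Fin 8 → ℝ) → ℝ},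
      (∀ t ∈ box D lo hi, ∃ v : Fin 8 → ℝ, (∀ i : Fin 8, MI.mem SC (v i) (getI g i)) ∧
        S t - S (centre D lo hi) = ∑ i : Fin 8, (t i - centre D lo hi i) * v i) → (∀ A ∈ cuts, 0 < A) →
      (∀ T ∈ Ts, ∀ f ∈ T, 0 ≤ minNum f.2 lo hi) → (∀ P, prev = some P → ∀ f ∈ P, 0 ≤ minNum f.2 lo hi) →
      cutAcc D E LD lo hi cuts Ts prev g = some g' →
      ∀ t ∈ box D lo hi, ∃ v : Fin 8 → ℝ, (∀ i : Fin 8, MI.mem SC (v i) (getI g' i)) ∧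
        (S t + featRestP E prev cuts Ts t) - (S (centre D lo hi) + featRestP E prev cuts Ts (centre D lo hi))
          = ∑ i : Fin 8, (t i - centre D lo hi i) * v i
  | [A], [T], prev, g, g', S, hS, hA, hT, hP, h => by
    simp only [cutAcc] at h
    by_cases hnn : nonnegOK lo hi T true = true
    · rw [if_pos hnn] at h
      have hA0 : 0 < A := hA A (by simp)
      have hM : ∀ f ∈ mergePrev T prev, 0 ≤ minNum f.2 lo hi := minNum_mergePrev (hT T (by simp)) hP
      have h1 := accQ_sound hD hE hA0 hle (mergePrev T prev) hS hM
      have h2 := accLog_sound hD hLD hle T h1 (fun f hf hf0 => pos_of_nonnegOK hnn hf hf0) h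
      intro t ht
      obtain ⟨v, hv, e⟩ := h2 t ht
      refine ⟨v, hv, ?_⟩
      simp only [featRestP, featRest, List.getD_cons_zero, entG_mergePrev] at e ⊢
      cases prev with
      | none => simp only at e ⊢; linarith
      | some P => simp only at e ⊢; linarith
    · rw [if_neg hnn] at h; simp at h
  | A :: A' :: As, T :: Ts, prev, g, g', S, hS, hA, hT, hP, h => by
    simp only [cutAcc] at h
    have hA0 : 0 < A := hA A (by simp)
    have hM : ∀ f ∈ mergePrev T prev, 0 ≤ minNum f.2 lo hi := minNum_mergePrev (hT T (by simp)) hP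
    have h1 := accQ_sound hD hE hA0 hle (mergePrev T prev) hS hM
    have h2 := cutAcc_sound hD hE hLD hle (A' :: As) Ts (some T) h1 (fun B hB => hA B (by simp [hB]))
      (fun T' hT' => hT T' (by simp [hT'])) (fun P hp => by cases hp; exact hT T (by simp)) h
    intro t ht
    obtain ⟨v, hv, e⟩ := h2 t ht
    refine ⟨v, hv, ?_⟩
    simp only [featRestP, featRest, List.getD_cons_zero, entG_mergePrev] at e ⊢
    cases prev with
    | none => simp only at e ⊢; linarith
    | some P => simp only at e ⊢; linarith
  | [], _, _, _, _, _, _, _, _, _, h => by simp [cutAcc] at h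
  | [_], [], _, _, _, _, _, _, _, _, h => by simp [cutAcc] at h
  | [_], _ :: _ :: _, _, _, _, _, _, _, _, _, h => by simp [cutAcc] at h
  | _ :: _ :: _, [], _, _, _, _, _, _, _, _, h => by simp [cutAcc] at h


end LemmaFWinBox

end Summit.KontsevichZagierPeriods.Zeta5Search.Barrier.ConeGamma
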